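import Summits.AnomalousDissipation.AnomalousDissipation.Theorems.QuarticGate.Negative.EnergyRow

/-!
# Stub `stub_taylorReduction` of the line `taylor-cone-homogenisation`
# (crux stmt-AnomalousDissipation-14283, `MomentParity.GalerkinInvariantLoud`)

**S2 — TAYLOR REDUCTION (the Transfer `C⁺ → crux`): a Taylor-scale ensemble IS loud and bounded.**
From the ENERGY FLOOR (S1, taken verbatim as the first hypothesis: every level-`N` probability law with
finite mean energy and vanishing linear rows at `0 < ν ≤ ν₀`, `N ≥ N₀` has `e(μ) ≥ e₀ > 0`) and a
TAYLOR-SCALE ENSEMBLE (second hypothesis: `f ≠ 0`, `ν_j → 0⁺`, `κ > 0`, per `j` `N`-frequently an all-order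
invariant level-`N` law supported in a ball and IN THE CONE `κ e(μ) ≤ D(μ)`), the crux's window follows:

* ceiling — the landed energy row `D ≤ ‖f‖₂ √e` (`ensembleDissipation_le_of_polyStationary`) and the cone give
  `κ e ≤ ‖f‖₂ √e`, whence `e ≤ E := ‖f‖₂² / κ²` (`energy_le_of_cone`);
* loudness — after re-indexing the viscosities past `ν₀` (`ν' j := ν (j + J)`) and intersecting `∃ᶠ N` with
  `∀ᶠ N, N₀ ≤ N`, the floor gives `D ≥ κ e ≥ κ e₀ =: ε > 0`.

Pure bookkeeping over landed vocabulary (`IsLevel`, `IsBandTest`, `polyGrad`, `IsPolyStationary` of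
`Theorems/QuarticGate/Negative/LevelCeiling.lean`, the energy row of `…/EnergyRow.lean`); the mathematics is
folklore (Cauchy–Schwarz on the energy row, Doering–Foias 2002 §2).
-/

set_option linter.dupNamespace false

noncomputable section

namespace Summit.AnomalousDissipation.AnomalousDissipation.Theorems.GalerkinInvariantLoud.TaylorReduction

open MeasureTheory Filter Topology Set
open scoped ENNReal
open Literature.Analysis.FunctionSpaces Literature.Analysis.FluidPDE
open Summit.AnomalousDissipation.AnomalousDissipation.Theses.MomentParity
open Summit.AnomalousDissipation.AnomalousDissipation.Theorems.QuarticGate.Negative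

/-! ## Two helpers -/

/-- A law supported in a ball has moments of every order (same proof as the landed
`GalerkinInvariantLoud.Negative.integrable_norm_pow_of_ae_le`, restated to keep the imports minimal). [folklore] -/
theorem integrable_norm_pow_of_ae_le {μ : Measure (Torus.energySpace (Fin 3))} [IsFiniteMeasure μ] {R : ℝ}
    (hR : ∀ᵐ u ∂μ, ‖u‖ ≤ R) (p : ℕ) : Integrable (fun u : Torus.energySpace (Fin 3) => ‖u‖ ^ p) μ := by
  refine Integrable.mono' (integrable_const (max R 0 ^ p)) (continuous_norm.pow p).aestronglyMeasurable ?_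
  filter_upwards [hR] with u hu
  rw [Real.norm_of_nonneg (by positivity)]
  exact pow_le_pow_left₀ (norm_nonneg _) (hu.trans (le_max_left _ _)) p

/-- **Cone arithmetic (the energy ceiling).** `κ e ≤ √F √e` with `0 < κ`, `0 ≤ e`, `0 ≤ F` forces
`e ≤ F / κ²` (square after cancelling `√e`; trivial if `e = 0`). [folklore] -/
theorem energy_le_of_cone {κ e F : ℝ} (hκ : 0 < κ) (he : 0 ≤ e) (hF : 0 ≤ F)
    (h : κ * e ≤ Real.sqrt F * Real.sqrt e) : e ≤ F / κ ^ 2 := by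
  rw [le_div_iff₀ (pow_pos hκ 2)]
  rcases he.eq_or_lt with h0 | hpos
  · rw [← h0, zero_mul]
    exact hF
  · have hse : 0 < Real.sqrt e := Real.sqrt_pos.2 hpos
    have h1 : κ * Real.sqrt e ≤ Real.sqrt F := by
      refine le_of_mul_le_mul_right ?_ hse
      calc κ * Real.sqrt e * Real.sqrt e = κ * e := by rw [mul_assoc, Real.mul_self_sqrt he]
        _ ≤ Real.sqrt F * Real.sqrt e := h
    have h2 : (κ * Real.sqrt e) ^ 2 ≤ Real.sqrt F ^ 2 := pow_le_pow_left₀ (by positivity) h1 2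
    rw [mul_pow, Real.sq_sqrt he, Real.sq_sqrt hF] at h2
    linarith [h2]

/-! ## The stub -/

/-- **S2 — TAYLOR REDUCTION (the Transfer `C⁺ → crux`): a Taylor-scale ensemble IS loud and bounded.**
Hypotheses: the energy floor S1 (verbatim) and TSE = "`∃ f` smooth div-free mean-zero, `f ≠ 0`, `ν_j → 0⁺`,
`κ > 0`, `∀ j ∃ R ∃ᶠ N ∃ μ` probability, level-`N` carried, supported in `‖u‖ ≤ R`, all-order invariant
(`∀ d, IsPolyStationary (ν j) f N d μ`), IN THE CONE `κ∫|u|²dμ ≤ ν_j∫‖∇u‖²dμ`". Conclusion: the crux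
`MomentParity.GalerkinInvariantLoud`, unfolded clause for clause.
Proof: `e₀, ν₀, N₀` from S1 for this `f`; `J` with `ν_j ≤ ν₀` for `j ≥ J` and `ν' j := ν (j + J)`;
`E := ‖f‖₂²/κ²` from the energy row `D ≤ ‖f‖₂√e` and the cone (`energy_le_of_cone`); `ε := κ e₀` from the
floor and the cone, inside `∃ᶠ N` intersected with `∀ᶠ N, N₀ ≤ N`; all-order rows from
`hinv : ∀ d, IsPolyStationary …` at `d := P.totalDegree + 1`. [folklore] -/
theorem stub_taylorReduction :
    (∀ f : UnitAddTorus (Fin 3) → EuclideanSpace ℝ (Fin 3),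
      Torus.IsSmooth f → Torus.IsDivFree f → Torus.HasZeroMean f → f ≠ 0 →
      ∃ e₀ ν₀ : ℝ, 0 < e₀ ∧ 0 < ν₀ ∧ ∃ N₀ : ℕ, ∀ ν : ℝ, 0 < ν → ν ≤ ν₀ → ∀ N : ℕ, N₀ ≤ N →
        ∀ μ : Measure (Torus.energySpace (Fin 3)), IsProbabilityMeasure μ →
          (∀ᵐ u ∂μ, IsLevel N u) →
          Integrable (fun u : Torus.energySpace (Fin 3) => ‖u‖ ^ 2) μ →
          IsPolyStationary ν f N 2 μ →
          e₀ ≤ Torus.ensembleEnergy μ) →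
    (∃ f : UnitAddTorus (Fin 3) → EuclideanSpace ℝ (Fin 3),
      Torus.IsSmooth f ∧ Torus.IsDivFree f ∧ Torus.HasZeroMean f ∧ f ≠ 0 ∧
      ∃ (ν : ℕ → ℝ) (κ : ℝ), (∀ j, 0 < ν j) ∧ Tendsto ν atTop (𝓝 0) ∧ 0 < κ ∧
        ∀ j : ℕ, ∃ R : ℝ, ∃ᶠ N in atTop, ∃ μ : Measure (Torus.energySpace (Fin 3)),
          IsProbabilityMeasure μ ∧ (∀ᵐ u ∂μ, IsLevel N u) ∧ (∀ᵐ u ∂μ, ‖u‖ ≤ R) ∧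
          (∀ d : ℕ, IsPolyStationary (ν j) f N d μ) ∧
          κ * Torus.ensembleEnergy μ ≤ Torus.ensembleDissipation (ν j) μ) →
    ∃ f : UnitAddTorus (Fin 3) → EuclideanSpace ℝ (Fin 3),
      Torus.IsSmooth f ∧ Torus.IsDivFree f ∧ Torus.HasZeroMean f ∧
      ∃ (ν : ℕ → ℝ) (E ε : ℝ), (∀ j, 0 < ν j) ∧ Tendsto ν atTop (𝓝 0) ∧ 0 < ε ∧
        ∀ j : ℕ, ∃ R : ℝ, ∃ᶠ N in atTop, ∃ μ : Measure (Torus.energySpace (Fin 3)),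
          IsProbabilityMeasure μ ∧ (∀ᵐ u ∂μ, IsLevel N u) ∧ (∀ᵐ u ∂μ, ‖u‖ ≤ R) ∧
          (∀ (m : ℕ) (g : Fin m → UnitAddTorus (Fin 3) → EuclideanSpace ℝ (Fin 3))
              (P : MvPolynomial (Fin m) ℝ), (∀ i, IsBandTest N (g i)) →
            Integrable (fun u => Torus.nsGeneratorPairing (ν j) f u (polyGrad g P u)) μ ∧
              ∫ u, Torus.nsGeneratorPairing (ν j) f u (polyGrad g P u) ∂μ = 0) ∧
          Torus.ensembleEnergy μ ≤ E ∧ ε ≤ Torus.ensembleDissipation (ν j) μ := by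
  intro hFloor hTSE
  obtain ⟨f, hfs, hfd, hfz, hf0, ν, κ, hν, hν0, hκ, hj⟩ := hTSE
  -- (floor) the thresholds of S1 for this force
  obtain ⟨e₀, ν₀, he₀, hν₀, N₀, hfloor⟩ := hFloor f hfs hfd hfz hf0
  -- (re-index) `ν_j → 0` gives `J` with `ν_j ≤ ν₀` for `j ≥ J`
  obtain ⟨J, hJ⟩ : ∃ J : ℕ, ∀ j ≥ J, ν j ≤ ν₀ :=
    eventually_atTop.1 (hν0.eventually (eventually_le_nhds hν₀))
  refine ⟨f, hfs, hfd, hfz, fun j => ν (j + J), (∫ x, ‖f x‖ ^ 2) / κ ^ 2, κ * e₀,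
    fun j => hν (j + J), hν0.comp (tendsto_add_atTop_nat J), mul_pos hκ he₀, fun j => ?_⟩
  obtain ⟨R, hR⟩ := hj (j + J)
  refine ⟨R, (hR.and_eventually (eventually_ge_atTop N₀)).mono ?_⟩
  rintro N ⟨⟨μ, hp, hl, hRμ, hinv, hcone⟩, hN⟩
  haveI := hp
  have h2 : Integrable (fun u : Torus.energySpace (Fin 3) => ‖u‖ ^ 2) μ :=
    integrable_norm_pow_of_ae_le hRμ 2
  have he : 0 ≤ Torus.ensembleEnergy μ := integral_nonneg fun u => by positivity
  -- (ceiling) the energy row `D ≤ ‖f‖₂ √e` from 3-stationarity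
  have hceil : Torus.ensembleDissipation (ν (j + J)) μ ≤
      Real.sqrt (∫ x, ‖f x‖ ^ 2) * Real.sqrt (Torus.ensembleEnergy μ) :=
    ensembleDissipation_le_of_polyStationary f (hfs.memLp 2) hl h2 le_rfl (hinv 3)
  -- (loud) the energy floor `e₀ ≤ e` from 2-stationarity at `0 < ν (j + J) ≤ ν₀`, `N₀ ≤ N`
  have hfl : e₀ ≤ Torus.ensembleEnergy μ :=
    hfloor (ν (j + J)) (hν (j + J)) (hJ (j + J) (Nat.le_add_left J j)) N hN μ hp hl h2 (hinv 2)
  refine ⟨μ, hp, hl, hRμ, fun m g P hg => hinv (P.totalDegree + 1) m g P hg le_rfl, ?_, ?_⟩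
  · exact energy_le_of_cone hκ he (integral_nonneg fun x => by positivity) (hcone.trans hceil)
  · calc κ * e₀ ≤ κ * Torus.ensembleEnergy μ := mul_le_mul_of_nonneg_left hfl hκ.le
      _ ≤ Torus.ensembleDissipation (ν (j + J)) μ := hcone

end Summit.AnomalousDissipation.AnomalousDissipation.Theorems.GalerkinInvariantLoud.TaylorReduction
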